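import Summits.CriticalPhenomena.Ising3DConformalLimit.Theses.WeylWindow
import Summits.CriticalPhenomena.Ising3DConformalLimit.Theses.HyperoctahedralRP
import Summits.CriticalPhenomena.Ising3DConformalLimit.Theorems.HyperoctahedralRPHRP2Rigidity
import Summits.CriticalPhenomena.Ising3DConformalLimit.Theorems.HyperoctahedralRPLimitRotationInvariant
import Summits.CriticalPhenomena.Ising3DConformalLimit.Theorems.InversionUpgradeNormalised.Negative.AutomaticOrders
import Summits.CriticalPhenomena.Ising3DConformalLimit.Theorems.MoebiusLimitExists.Negative.ScaleRedundant
import HarnessLib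

/-!
# Crux `WeylWindow.WeylTransfer` (stmt-CriticalPhenomena-4737) — birth skeleton (BC3)

Skeleton-register seat `planner-skel-stmt-CriticalPhenomena-4737-0`, 2026-08-17 (route re-audit bin REPAIRABLE),
published as `Cruxes/WeylTransfer/Lines/birth.lean` (crux dir empty before this: no Disproof, no ideas, no lines).

The crux (rank 3 of route `WeylWindow`, "the device deliverable, conditional on K"):

  `WeylTransfer := EnergyShadowSummable → ∀ ρ S, (ρ > 0 on (0,1]) → HasPointwiseScalingLimit (criticalCorr 3) ρ S →
     (S = 0 off NonCoincident) → IsNondegenerateTwoPoint S → IsTranslationInvariant S → ∃ Δ > 0, IsMoebiusCovariant Δ S`,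

`K = EnergyShadowSummable` being the route's rank-2 crux (`Σ_x ‖x‖⁻¹|⟨ε₀;ε_x⟩_{β_c}| < ∞`, the window `Δ_ε > d − 2 = 1`).

## What the tree already gives (2026-08-17) — three of the four Möbius generators and the weight

For `ρ, S` as in the crux (normalised, non-degenerate pointwise limit of `criticalCorr 3`, translation invariant):
* SCALE COVARIANCE WITH SOME `Δ` is automatic: `MoebiusLimitExistsNegative.exists_scaleCovariant_on_nonCoincident`
  (`Theorems/MoebiusLimitExists/Negative/ScaleFree.lean`: `ρ(cδ)/ρ(δ) → Φ(c)`, Messager–Miracle-Solé monotonicity, measurable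
  Cauchy equation) + normalisation off `NonCoincident` (`isScaleCovariant_of_hypotheses` below, sorry-free);
* the WEIGHT IS PINNED, `Δ ∈ [1/2, 1]` (`InversionUpgradeNormalisedNegative.delta_mem_Icc_of_hyp` = tree
  `scalingDimension_mem_Icc_holds`: infrared bound + Simon–Lieb), in particular `0 < Δ`;
* `O(3)` INVARIANCE is a theorem: items 1979 (`Cruxes.HRP2Rigidity.XRayMellin.HRP2Rigidity_of`) + 1980
  (`Cruxes.LimitRotationInvariant.QuarterTurnLiouville.limitRotationInvariant_proof`) of route `HyperoctahedralRP`, both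
  closed/proved (`isEuclideanInvariant_of_hypotheses` below, sorry-free);
* of the remaining generator, the unit INVERSION, the orders `n = 0`, `n = 2` and all odd `n` are automatic
  (`InversionUpgradeNormalisedNegative.invIdentity_zero/two/odd`, `crux_iff_evenFromFour`,
  `Theorems/InversionUpgradeNormalised/Negative/AutomaticOrders.lean`).

Consequence, kernel-checked here (`WeylTransfer_iff_window1982`, sorry-free):

  `WeylTransfer ↔ (EnergyShadowSummable → HyperoctahedralRP.InversionUpgradeNormalised)`   (item stmt-CriticalPhenomena-1982)

— the crux IS "item 1982 in the window K", with ZERO slack (the converse uses the landed weight uniqueness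
`MoebiusLimitExistsNegative.delta_eq_of_inversion_of_scale`). In particular `WeylTransfer_of_inversionUpgradeNormalised :
InversionUpgradeNormalised → WeylTransfer`: if the shared item 1982 (12 routes) lands, this crux closes with `K` unused —
the refuter's route-review objection ("K decorative at the typed level") made precise; what the route ADDS is the bet that
the window `K` makes the inversion upgrade provable by the Poisson–Delaunay device transfer (below).

## The line (two registered stubs, the ONLY `sorry`s of this file): the K-window inversion identity, cut by arity

By `crux_iff_evenFromFour` the whole open content is the inversion identity `S_n(ιx) = (∏‖xᵢ‖^{2Δ}) S_n(x)` (`xᵢ ≠ 0`) at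
EVEN orders `n ≥ 4`, for normalised, non-degenerate, Euclidean-invariant, scale-covariant limits of `criticalCorr 3`.
The two stubs are its `K`-conditional halves:
* `stub_windowInversionFour`   — `K →` the identity at order `n = 4` (equivalently: the scaling limit of the connected
  four-point function `U₄ = −2 S₂S₂·P[double-current clusters intersect]`, Aizenman 1982 / ADC 2021 (3.11), is inversion
  covariant — the intersection probability of the sourced double current is conformally INVARIANT in the limit);
* `stub_windowInversionHigher` — `K →` the identity at every even order `n ≥ 6`.
The arity seam is a genuine one: MODEL-BLINDLY the order-4 identity (indeed all orders ≤ 5) together with (H3)–(H6),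
`U₄ ≢ 0` and the Lebowitz sign does NOT propagate to order 6 (`Negative/SixPoint.lean`: `fourPoint_does_not_propagate`,
`not_inversionUpgrade_from_low_orders`, witness `sixFamily Δ`); conversely "even orders ≥ 6 ⇒ order 4" would need a
cluster/OPE exchange of limits nobody has. It is also the seam of item 1982's own registered line (`inversion-defect-
involution`: open stubs C = `stub_latticeFour`, D = `stub_latticeHigher`, one-sided weight-free lattice ratio forms,
`Theorems/HyperoctahedralRPInversionUpgradeNormalised.lean`); 1982's C ⇒ our stub 1 and D ⇒ our stub 2 outright (drop `K`,
apply the landed squeeze), so either chain closes these stubs.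

INTENDED MECHANISM for both stubs (route WeylWindow, cards conformal-poisson-devices / weyl-universality-needs-interaction;
informal — device-level typing is crux-plan work now that `delaunayGraph` and `pdCorr` (`Literature/Probability/LatticeModels/
DelaunayGraph.lean`, `PoissonDelaunayIsing.lean`) are in tree, but `β_c^{PD}`, measurability of `quenchedCorr` and an
`N → ∞` device scaling-limit predicate are not): (1) DeviceExactSymmetry — the n.n. Ising model on the Delaunay graph of
the Poisson process of intensity `N(1+‖x‖²)⁻³dx` is `O(4)`-symmetric in law (Poisson mapping theorem, Last–Penrose Thm 5.1,
+ Möbius equivariance of empty balls, landed in `DelaunayGraph.lean`), and `O(4) ∋` the unit inversion; (2) Weyl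
universality for `C²` log-densities `m`: `r(N)ⁿ E⟨∏σ_{p(xᵢ)}⟩_{N·m} → ∏ m(xᵢ)^{-Δ/3} · T_n(x)`, whose only second-order
anomaly is the curvature ⊗ energy channel with coefficient `ℓ^{Δ_ε−1}(∂² log m)`, summable iff `K` (card N3) — this is
where `K` is load-bearing and why the unconditional statement is believed FALSE for the free field
(`MinimalCouplingCurvatureDefect`, item 4740: the Gaussian rung flunks Weyl universality by `−Δ√Ω/‖x−y‖`);
(3) SectorIdentification `ℤ³ ↔` homogeneous Poisson–Delaunay (same spin `n`-point limits up to one constant, energy-shadow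
summability transfers). (1)+(2)+(3) give the inversion identity at ALL orders at once, i.e. both stubs by one argument; the
arity cut only records which proper parts a partial result would settle.

## Composition

`WeylTransfer_of : Sig.stub_windowInversionFour → Sig.stub_windowInversionHigher → WeylWindow.WeylTransfer` (sorry-free):
the two stubs give `K → InversionUpgradeNormalised` through `crux_iff_evenFromFour` (`window1982_of_stubs`), and
`WeylTransfer_of_window1982` assembles `∃ Δ > 0, IsMoebiusCovariant Δ S` from the landed scale weight, window, rotation
theorem and that. `WeylTransfer_of_stubs : WeylTransfer` from the registered stubs (kernel-checks `Sig.stub_X ≡` the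
registered signature of `stub_X`).

Disproof used: none exists for stmt-4737 (`ledger crux ls`: no workfiles at registration). Honoured from item 1982's landed
negatives (`Theorems/InversionUpgradeNormalised/Negative/*`): `LoadBearingHypotheses` (`not_cruxWithoutIsingLimit`,
`not_cruxWithoutNormalisation`, `not_cruxWithoutScaleCovariance`) — both stubs keep (H2) the `criticalCorr 3` limit clause,
(H3) normalisation and (H6) scale covariance, so no stub is an instance of a refuted model-blind surrogate
(`ScaleCovarianceNotMoebius`, `ReflectionMonotone`, `SixPointWitness` all drop (H2)); `SixPoint` — justifies the cut (above);
`SharperWindow` — every instance has `Δ ∈ [1/2, 3/4]`, consistent with the bootstrap value `Δ_σ = 0.518`; `LoadBearing…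
inversion_weight_eq` / `ScaleRedundant.delta_eq_of_inversion_of_scale` — used for the zero-slack converse. Negatives index
(`ledger negatives --problem CriticalPhenomena`, 11 entries, 2026-08-17): none concerns Ising3DConformalLimit statements.
-/

noncomputable section

namespace Summit.CriticalPhenomena.Ising3DConformalLimit.Cruxes.WeylTransfer.Birth

open Literature.Probability.LatticeModels EuclideanGeometry
open Summit.CriticalPhenomena.Ising3DConformalLimit.Theses
open Summit.CriticalPhenomena.Ising3DConformalLimit.InversionUpgradeNormalisedNegative
  (invIdentity_zero invIdentity_odd invIdentity_two crux_iff_evenFromFour delta_mem_Icc_of_hyp)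
open Summit.CriticalPhenomena.Ising3DConformalLimit.MoebiusLimitExistsNegative
  (exists_scaleCovariant_on_nonCoincident smul_mem_nonCoincident_iff delta_eq_of_inversion_of_scale)

/-! ## §1 The stub statements as named propositions (verbatim the registered signatures) -/

/-- Statement of `stub_windowInversionFour`: in the window `K`, the inversion identity at order `4` for every normalised,
non-degenerate, Euclidean-invariant, scale-covariant (weight `Δ`) pointwise limit of `criticalCorr 3`. -/
def Sig.stub_windowInversionFour : Prop :=
  Summit.CriticalPhenomena.Ising3DConformalLimit.Theses.WeylWindow.EnergyShadowSummable →
  ∀ (ρ : ℝ → ℝ) (Δ : ℝ) (S : Literature.Probability.LatticeModels.CorrFamily 3), (∀ δ ∈ Set.Ioc (0:ℝ) 1, 0 < ρ δ)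
  → Literature.Probability.LatticeModels.HasPointwiseScalingLimit (Literature.Probability.LatticeModels.criticalCorr 3) ρ S
  → (∀ n z, z ∉ Literature.Probability.LatticeModels.NonCoincident 3 n → S n z = 0)
  → Literature.Probability.LatticeModels.IsNondegenerateTwoPoint S
  → Literature.Probability.LatticeModels.IsEuclideanInvariant S
  → Literature.Probability.LatticeModels.IsScaleCovariant Δ S
  → ∀ x : Fin 4 → EuclideanSpace ℝ (Fin 3), (∀ i, x i ≠ 0) →
      S 4 (fun i => EuclideanGeometry.inversion (0 : EuclideanSpace ℝ (Fin 3)) 1 (x i)) = (∏ i, ‖x i‖ ^ (2 * Δ)) * S 4 x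

/-- Statement of `stub_windowInversionHigher`: in the window `K`, the inversion identity at every EVEN order `n ≥ 6` for
every normalised, non-degenerate, Euclidean-invariant, scale-covariant (weight `Δ`) pointwise limit of `criticalCorr 3`. -/
def Sig.stub_windowInversionHigher : Prop :=
  Summit.CriticalPhenomena.Ising3DConformalLimit.Theses.WeylWindow.EnergyShadowSummable →
  ∀ (ρ : ℝ → ℝ) (Δ : ℝ) (S : Literature.Probability.LatticeModels.CorrFamily 3), (∀ δ ∈ Set.Ioc (0:ℝ) 1, 0 < ρ δ)
  → Literature.Probability.LatticeModels.HasPointwiseScalingLimit (Literature.Probability.LatticeModels.criticalCorr 3) ρ S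
  → (∀ n z, z ∉ Literature.Probability.LatticeModels.NonCoincident 3 n → S n z = 0)
  → Literature.Probability.LatticeModels.IsNondegenerateTwoPoint S
  → Literature.Probability.LatticeModels.IsEuclideanInvariant S
  → Literature.Probability.LatticeModels.IsScaleCovariant Δ S
  → ∀ n : ℕ, 6 ≤ n → Even n → ∀ x : Fin n → EuclideanSpace ℝ (Fin 3), (∀ i, x i ≠ 0) →
      S n (fun i => EuclideanGeometry.inversion (0 : EuclideanSpace ℝ (Fin 3)) 1 (x i)) = (∏ i, ‖x i‖ ^ (2 * Δ)) * S n x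

/-! ## §2 Registered stubs (the ONLY `sorry`s of this file) -/

/-- **Stub 1 (order four, in the window).** Assuming `EnergyShadowSummable` (route crux K, `Δ_ε > 1` in summable form):
for every `ρ > 0` on `(0,1]`, `Δ`, and every pointwise scaling limit `S` of `criticalCorr 3` that is normalised
(`S = 0` off `NonCoincident`), non-degenerate, Euclidean invariant and scale covariant with weight `Δ`, the four-point
function obeys the unit-inversion identity `S₄(x₁/‖x₁‖², …, x₄/‖x₄‖²) = (∏‖xᵢ‖^{2Δ}) S₄(x)` for all `xᵢ ≠ 0`.
Intended proof: Poisson–Delaunay device transfer (exact `O(4)` symmetry of the `(1+‖x‖²)⁻³` device + Weyl universality,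
whose curvature ⊗ ε anomaly `K` kills + sector identification `ℤ³ ↔ PD`). Implied outright by item 1982 / its lattice stub
`stub_latticeFour`. Open; every model-blind surrogate is refuted (keep (H2), (H3), (H6)). Size XL. -/
theorem stub_windowInversionFour :
    Summit.CriticalPhenomena.Ising3DConformalLimit.Theses.WeylWindow.EnergyShadowSummable →
    ∀ (ρ : ℝ → ℝ) (Δ : ℝ) (S : Literature.Probability.LatticeModels.CorrFamily 3), (∀ δ ∈ Set.Ioc (0:ℝ) 1, 0 < ρ δ)
    → Literature.Probability.LatticeModels.HasPointwiseScalingLimit (Literature.Probability.LatticeModels.criticalCorr 3) ρ S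
    → (∀ n z, z ∉ Literature.Probability.LatticeModels.NonCoincident 3 n → S n z = 0)
    → Literature.Probability.LatticeModels.IsNondegenerateTwoPoint S
    → Literature.Probability.LatticeModels.IsEuclideanInvariant S
    → Literature.Probability.LatticeModels.IsScaleCovariant Δ S
    → ∀ x : Fin 4 → EuclideanSpace ℝ (Fin 3), (∀ i, x i ≠ 0) →
        S 4 (fun i => EuclideanGeometry.inversion (0 : EuclideanSpace ℝ (Fin 3)) 1 (x i)) = (∏ i, ‖x i‖ ^ (2 * Δ)) * S 4 x := by
  sorry

/-- **Stub 2 (even orders `≥ 6`, in the window).** Same hypotheses; conclusion: the unit-inversion identity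
`S_n(ιx) = (∏‖xᵢ‖^{2Δ}) S_n(x)` (`xᵢ ≠ 0`) at every even order `n ≥ 6`. Intended proof: the same device transfer gives
all orders at once; recorded separately because order 4 does not propagate to order 6 model-blindly
(`Negative/SixPoint.lean`). Implied outright by item 1982 / its lattice stub `stub_latticeHigher`. Open. Size XL. -/
theorem stub_windowInversionHigher :
    Summit.CriticalPhenomena.Ising3DConformalLimit.Theses.WeylWindow.EnergyShadowSummable →
    ∀ (ρ : ℝ → ℝ) (Δ : ℝ) (S : Literature.Probability.LatticeModels.CorrFamily 3), (∀ δ ∈ Set.Ioc (0:ℝ) 1, 0 < ρ δ)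
    → Literature.Probability.LatticeModels.HasPointwiseScalingLimit (Literature.Probability.LatticeModels.criticalCorr 3) ρ S
    → (∀ n z, z ∉ Literature.Probability.LatticeModels.NonCoincident 3 n → S n z = 0)
    → Literature.Probability.LatticeModels.IsNondegenerateTwoPoint S
    → Literature.Probability.LatticeModels.IsEuclideanInvariant S
    → Literature.Probability.LatticeModels.IsScaleCovariant Δ S
    → ∀ n : ℕ, 6 ≤ n → Even n → ∀ x : Fin n → EuclideanSpace ℝ (Fin 3), (∀ i, x i ≠ 0) →
        S n (fun i => EuclideanGeometry.inversion (0 : EuclideanSpace ℝ (Fin 3)) 1 (x i)) = (∏ i, ‖x i‖ ^ (2 * Δ)) * S n x := by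
  sorry

/-! ## §3 Landed inputs, isolated (sorry-free) -/

/-- **Scale covariance with a weight in the Ising window is automatic** for a normalised, non-degenerate pointwise limit of
`criticalCorr 3` (`ρ > 0` on `(0,1]`): `exists_scaleCovariant_on_nonCoincident` on `NonCoincident`, the normalisation
hypothesis off it, and `delta_mem_Icc_of_hyp` (`scalingDimension_mem_Icc_holds`) for `Δ ∈ [1/2, 1]`. -/
theorem isScaleCovariant_of_hypotheses {ρ : ℝ → ℝ} {S : CorrFamily 3}
    (hρ : ∀ δ ∈ Set.Ioc (0:ℝ) 1, 0 < ρ δ) (hlim : HasPointwiseScalingLimit (criticalCorr 3) ρ S)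
    (hnorm : ∀ n z, z ∉ NonCoincident 3 n → S n z = 0) (hnd : IsNondegenerateTwoPoint S) :
    ∃ Δ : ℝ, Δ ∈ Set.Icc (1 / 2 : ℝ) 1 ∧ IsScaleCovariant Δ S := by
  obtain ⟨Δ, -, hscNC⟩ := exists_scaleCovariant_on_nonCoincident hρ hlim hnd
  have hsc : IsScaleCovariant Δ S := by
    intro n c hc x
    by_cases hx : x ∈ NonCoincident 3 n
    · exact hscNC n c hc x hx
    · rw [hnorm n x hx, hnorm n _ (mt (smul_mem_nonCoincident_iff hc.ne' x).1 hx), mul_zero]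
  exact ⟨Δ, delta_mem_Icc_of_hyp hρ hlim hnd hsc, hsc⟩

/-- **Euclidean invariance** under the hypotheses of the crux plus scale covariance: translations are given, `O(3)` is
the landed theorem of items 1979 + 1980 (route `HyperoctahedralRP`). -/
theorem isEuclideanInvariant_of_hypotheses {ρ : ℝ → ℝ} {Δ : ℝ} {S : CorrFamily 3}
    (hρ : ∀ δ ∈ Set.Ioc (0:ℝ) 1, 0 < ρ δ) (hlim : HasPointwiseScalingLimit (criticalCorr 3) ρ S)
    (hnorm : ∀ n z, z ∉ NonCoincident 3 n → S n z = 0) (hnd : IsNondegenerateTwoPoint S)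
    (htr : IsTranslationInvariant S) (hsc : IsScaleCovariant Δ S) : IsEuclideanInvariant S :=
  ⟨htr,
    Summit.CriticalPhenomena.Ising3DConformalLimit.Cruxes.LimitRotationInvariant.QuarterTurnLiouville.limitRotationInvariant_proof
      Summit.CriticalPhenomena.Ising3DConformalLimit.Cruxes.HRP2Rigidity.XRayMellin.HRP2Rigidity_of
      ρ Δ S hρ hlim hnorm hnd htr hsc⟩

/-! ## §4 The crux is item 1982 in the window `K` — zero slack (sorry-free) -/

/-- **`(K → item 1982) → WeylTransfer`.** Fix `K`, `ρ`, `S` and the hypotheses of the crux; the landed inputs give a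
weight `Δ ∈ [1/2,1]` with scale covariance and Euclidean invariance; the hypothesis supplies inversion covariance. -/
theorem WeylTransfer_of_window1982
    (h : WeylWindow.EnergyShadowSummable → HyperoctahedralRP.InversionUpgradeNormalised) :
    Summit.CriticalPhenomena.Ising3DConformalLimit.Theses.WeylWindow.WeylTransfer := by
  intro hK ρ S hρ hlim hnorm hnd htr
  obtain ⟨Δ, hwin, hsc⟩ := isScaleCovariant_of_hypotheses hρ hlim hnorm hnd
  have heuc : IsEuclideanInvariant S := isEuclideanInvariant_of_hypotheses hρ hlim hnorm hnd htr hsc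
  exact ⟨Δ, by linarith [hwin.1], heuc, hsc, h hK ρ Δ S hρ hlim hnorm hnd heuc hsc⟩

/-- **`WeylTransfer → (K → item 1982)`** (the converse; weight uniqueness `delta_eq_of_inversion_of_scale`). -/
theorem window1982_of_WeylTransfer
    (hWT : Summit.CriticalPhenomena.Ising3DConformalLimit.Theses.WeylWindow.WeylTransfer)
    (hK : WeylWindow.EnergyShadowSummable) : HyperoctahedralRP.InversionUpgradeNormalised := by
  intro ρ Δ S hρ hlim hnorm hnd heuc hsc
  obtain ⟨Δ', -, hM⟩ := hWT hK ρ S hρ hlim hnorm hnd heuc.1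
  have h : Δ' = Δ := delta_eq_of_inversion_of_scale hnd heuc.1 heuc.2 hsc hM.2.2
  subst h
  exact hM.2.2

/-- **ZERO SLACK: `WeylTransfer ↔ (EnergyShadowSummable → InversionUpgradeNormalised)`** — the crux is exactly
"item stmt-CriticalPhenomena-1982 in the window `K`", given the landed scale weight, window, `O(3)` theorem and weight
uniqueness. -/
theorem WeylTransfer_iff_window1982 :
    Summit.CriticalPhenomena.Ising3DConformalLimit.Theses.WeylWindow.WeylTransfer ↔
      (WeylWindow.EnergyShadowSummable → HyperoctahedralRP.InversionUpgradeNormalised) :=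
  ⟨window1982_of_WeylTransfer, WeylTransfer_of_window1982⟩

/-- **Item 1982 alone closes the crux** (`K` unused): if `HyperoctahedralRP.InversionUpgradeNormalised` lands, so does
`WeylTransfer`. -/
theorem WeylTransfer_of_inversionUpgradeNormalised (h1982 : HyperoctahedralRP.InversionUpgradeNormalised) :
    Summit.CriticalPhenomena.Ising3DConformalLimit.Theses.WeylWindow.WeylTransfer :=
  WeylTransfer_of_window1982 fun _ => h1982

/-! ## §5 Composition — the crux BY NAME from the two stubs (sorry-free) -/

/-- **The two stubs give item 1982 in the window**: orders `0`, `2`, odd are automatic (`crux_iff_evenFromFour`), order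
`4` is stub 1, even orders `≥ 6` are stub 2. -/
theorem window1982_of_stubs (h4 : Sig.stub_windowInversionFour) (h6 : Sig.stub_windowInversionHigher)
    (hK : WeylWindow.EnergyShadowSummable) : HyperoctahedralRP.InversionUpgradeNormalised := by
  rw [crux_iff_evenFromFour]
  intro ρ Δ S hρ hlim hnorm hnd heuc hsc n hn4 hev x hx
  by_cases hn6 : 6 ≤ n
  · exact h6 hK ρ Δ S hρ hlim hnorm hnd heuc hsc n hn6 hev x hx
  · have hlt : n < 6 := Nat.lt_of_not_le hn6
    interval_cases n
    · exact h4 hK ρ Δ S hρ hlim hnorm hnd heuc hsc x hx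
    · exact absurd hev (by decide)

/-- **COMPOSITION.** `Sig.stub_windowInversionFour → Sig.stub_windowInversionHigher → WeylTransfer`: the stubs give
`K → InversionUpgradeNormalised` (`window1982_of_stubs`), and `WeylTransfer_of_window1982` assembles
`∃ Δ > 0, IsMoebiusCovariant Δ S` from the landed scale weight (`Δ ∈ [1/2,1]`), the landed `O(3)` theorem and it.
Concludes `Summit.CriticalPhenomena.Ising3DConformalLimit.Theses.WeylWindow.WeylTransfer` by name. -/
theorem WeylTransfer_of :
    Sig.stub_windowInversionFour → Sig.stub_windowInversionHigher →
      Summit.CriticalPhenomena.Ising3DConformalLimit.Theses.WeylWindow.WeylTransfer :=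
  fun h4 h6 => WeylTransfer_of_window1982 (window1982_of_stubs h4 h6)

/-- The crux from the registered stubs (closed modulo exactly `stub_windowInversionFour`, `stub_windowInversionHigher`;
kernel-checks `Sig.stub_X ≡` the registered signature of `stub_X`). -/
theorem WeylTransfer_of_stubs : Summit.CriticalPhenomena.Ising3DConformalLimit.Theses.WeylWindow.WeylTransfer :=
  WeylTransfer_of stub_windowInversionFour stub_windowInversionHigher

end Summit.CriticalPhenomena.Ising3DConformalLimit.Cruxes.WeylTransfer.Birth

end
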